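import Summits.HubbardSuperconductivity.HubbardSuperconductivity.Theses.AbsenceCertificate
import Summits.HubbardSuperconductivity.HubbardSuperconductivity.Theorems.WeakCouplingBCSWcbcsBcsConstructionTrialStateBound
import Summits.HubbardSuperconductivity.HubbardSuperconductivity.Theorems.WeakCouplingBCSWcbcsBcsConstructionDoubleCommutatorBound
import Summits.HubbardSuperconductivity.HubbardSuperconductivity.Theorems.WeakCouplingBCSWcbcsBcsConstructionHamiltonianNormBound
import Summits.HubbardSuperconductivity.HubbardSuperconductivity.Theorems.WeakCouplingBCSWcbcsBcsConstructionLroSeedAbstract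
import Summits.HubbardSuperconductivity.HubbardSuperconductivity.Theorems.WeakCouplingBCSWcbcsSsbToTorusLROPairCommutatorBudget
import Literature.MathematicalPhysics.QuantumLattice.DWaveSourceProofs

/-!
# Route `AbsenceCertificate`: the engine `SourcedOrderDominatesLRO` (LRO forces sourced order)

Support item `stmt-HubbardSuperconductivity-9486` of route `HubbardSuperconductivity/AbsenceCertificate`
(rank 2, "the engine"): for ALL real `U, μ`, every particle-number function `N` and every family of
normalised `(N_L, S^z = 0)`-sector ground states `ψ_L` of `hubbardTorus 2 L 1 U` (even `L`) whose sectors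
are canonically supported by `μ` (the sector ground energy exceeds `μ N_L + E₀(H(1,U) - μN)` by `o(L²)`),
an eventual pair-field LRO bound `c L⁴ ≤ Re⟨ψ_L, Δ_d† Δ_d ψ_L⟩` forces, for every source `h > 0` and
every `ε > 0`, the finite-volume Koma–Tasaki order parameter `dWaveSourceDensity L U μ h` above
`√(c/2) - ε` for all large even `L`.

This is the Kaplan–Horsch–von der Linden / Koma–Tasaki direction "long-range order ⇒ symmetry breaking
under an infinitesimal source", proved with ONE symmetry-broken trial state
`Ξ = (ψ + Oψ/‖Oψ‖)/√2`, `O = Δ_d + Δ_d†` (T. A. Kaplan, P. Horsch, W. von der Linden, J. Phys. Soc. Jpn.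
58 (1989) 3894; T. Koma, H. Tasaki, J. Stat. Phys. 76 (1994) 745, proof of Theorem 2.2).

The operator analysis is imported from the tree (route `WeakCouplingBCS`, crux `WcbcsBcsConstruction`,
where the same trial state serves the opposite purpose): the abstract trial-state bound
`stub_wcbcsTrialStateAbstract` with its arithmetic `trial_bound_arith`, the graded-locality double
commutator bound `dc_norm_doubleCommutator_pairField_le` (`‖[O,[O,H]]‖ = O(L²)`), the pair-commutator
budget `stub_pairCommutatorBudget` (`|Re⟨[Δ_d†, Δ_d]⟩| = O(L²)`), the particle-number selection rule
`order_sq_expect_eq_pair` (`⟨O²⟩ = ⟨Δ_dΔ_d† + Δ_d†Δ_d⟩` in a number eigenstate) and the energy sandwich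
`groundEnergy_gain_le_dWaveSourceDensity` (`E(0) - E(h) ≤ 2hL²·m_L(h)`, which is `SourceSlopeBound`).
What is new here: (i) the volume bounds and the trial-state bound for ALL real `U` (the tree's stubs
assume `U ≥ 0`; the constant becomes `1 + |U| + |μ|`), (ii) the conversion of the item's hypothesis
`cL⁴ ≤ Re⟨Δ_d†Δ_d⟩` into `⟨O²⟩ ≥ 2cL⁴ - O(L²)` — this is where the constant `√(c/2)` (not `√c/2`) comes
from, (iii) the identification `Re⟨ψ_L, (H - μN)ψ_L⟩ - E₀(H - μN) = E_sec - μN_L - E₀^{gc} = o(L²)` for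
sector ground states, and (iv) the finite-`L` `ε`-bookkeeping. No definition is introduced; nothing is
assumed.
-/

set_option linter.dupNamespace false

noncomputable section

namespace Summit.HubbardSuperconductivity.HubbardSuperconductivity.Theorems.AbsenceCertificate

open Matrix Filter Literature.MathematicalPhysics.QuantumLattice Literature.Probability.LatticeModels
open Summit.HubbardSuperconductivity.HubbardSuperconductivity.Theses.AbsenceCertificate
open Summit.HubbardSuperconductivity.HubbardSuperconductivity.Theorems
open Summit.HubbardSuperconductivity.HubbardSuperconductivity.Theorems.WcbcsTrialState
open Summit.HubbardSuperconductivity.HubbardSuperconductivity.Theorems.WcbcsLroSeed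
open Summit.HubbardSuperconductivity.HubbardSuperconductivity.Theorems.WcbcsSsbToTorusLRO
open scoped Matrix.Norms.L2Operator ComplexOrder

/-! ### Volume bounds for all real `U` -/

/-- `‖H(1,U) - μN‖ ≤ 10 (1 + |U| + |μ|) L²` on the torus `(ℤ/Lℤ)²`, for ALL real `U`
(at most `5L²` local terms, each of norm `≤ 2 + |U| + 2|μ|`; the tree's `stub_hamiltonianNormBound`
is the case `U ≥ 0`). [folklore] -/
theorem kt_norm_hubbardTorusWith_le (L : ℕ) [NeZero L] (U μ : ℝ) :
    ‖hubbardTorusWith 2 L 1 U μ‖ ≤ 10 * (1 + |U| + |μ|) * (L : ℝ) ^ 2 := by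
  -- adapted from `stub_hamiltonianNormBound` (WeakCouplingBCSWcbcsBcsConstructionHamiltonianNormBound)
  have hcard : (Fintype.card (HubbardIdx (fermionTorusGraph 2 L)) : ℝ) ≤ 5 * (L : ℝ) ^ 2 := by
    exact_mod_cast card_hubbardIdx_fermionTorus_two_le L
  have hterm : 2 * |(1 : ℝ)| + |U| + 2 * |μ| ≤ 2 * (1 + |U| + |μ|) := by
    rw [abs_one]
    linarith [abs_nonneg U]
  rw [hubbardTorusWith, ← sum_hubbardTermOp]
  calc ‖∑ Z, hubbardTermOp (fermionTorusGraph 2 L) 1 U μ Z‖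
      ≤ ∑ Z, ‖hubbardTermOp (fermionTorusGraph 2 L) 1 U μ Z‖ := norm_sum_le _ _
    _ ≤ ∑ _Z : HubbardIdx (fermionTorusGraph 2 L), 2 * (1 + |U| + |μ|) :=
        Finset.sum_le_sum fun Z _ => (norm_hubbardTermOp_le _ 1 U μ Z).trans hterm
    _ = (Fintype.card (HubbardIdx (fermionTorusGraph 2 L)) : ℝ) * (2 * (1 + |U| + |μ|)) := by
        rw [Finset.sum_const, nsmul_eq_mul, Finset.card_univ]
    _ ≤ (5 * (L : ℝ) ^ 2) * (2 * (1 + |U| + |μ|)) :=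
        mul_le_mul_of_nonneg_right hcard (by positivity)
    _ = 10 * (1 + |U| + |μ|) * (L : ℝ) ^ 2 := by ring

/-- The double commutator of `O = Δ_d + Δ_d†` with `H(1,U) - μN`: `‖[O,[O,H]]‖ ≤ B₂ (1 + |U| + |μ|) L²`
for ALL real `U` (graded locality; the tree's `stub_doubleCommutatorBound` is the case `U ≥ 0`).
[cite: KomaTasaki1994, Theorem 2.2] -/
theorem kt_norm_doubleCommutator_le :
    ∃ B₂ : ℝ, 0 < B₂ ∧ ∀ (L : ℕ) [NeZero L] (U μ : ℝ),
      ‖(pairField dWaveFormFactor L + (pairField dWaveFormFactor L)ᴴ) *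
            ((pairField dWaveFormFactor L + (pairField dWaveFormFactor L)ᴴ) * hubbardTorusWith 2 L 1 U μ -
              hubbardTorusWith 2 L 1 U μ * (pairField dWaveFormFactor L + (pairField dWaveFormFactor L)ᴴ)) -
          ((pairField dWaveFormFactor L + (pairField dWaveFormFactor L)ᴴ) * hubbardTorusWith 2 L 1 U μ -
              hubbardTorusWith 2 L 1 U μ * (pairField dWaveFormFactor L + (pairField dWaveFormFactor L)ᴴ)) *
            (pairField dWaveFormFactor L + (pairField dWaveFormFactor L)ᴴ)‖ ≤
        B₂ * (1 + |U| + |μ|) * (L : ℝ) ^ 2 := by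
  -- adapted from `stub_doubleCommutatorBound` (WeakCouplingBCSWcbcsBcsConstructionDoubleCommutatorBound)
  set s : ℕ := (insert (0 : Site 2) unitSteps).card with hs_def
  set K : ℝ := 2 * ∑ e ∈ insert (0 : Site 2) unitSteps, |dWaveFormFactor e / Real.sqrt 2| with hK_def
  refine ⟨288 * (s : ℝ) ^ 2 * (s + 2) * K ^ 2 + 1, by positivity, fun L _ U μ => ?_⟩
  have key := dc_norm_doubleCommutator_pairField_le dWaveFormFactor L 1 U μ
  refine key.trans ?_
  have hJ : 2 * |(1 : ℝ)| + |U| + 2 * |μ| ≤ 2 * (1 + |U| + |μ|) := by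
    rw [abs_one]
    linarith [abs_nonneg μ, abs_nonneg U]
  have hL : (0 : ℝ) ≤ (L : ℝ) ^ 2 := by positivity
  have hC : (0 : ℝ) ≤ 144 * (s : ℝ) ^ 2 * (s + 2) * K ^ 2 := by positivity
  have h1 : (0 : ℝ) ≤ 1 + |U| + |μ| := by positivity
  calc 144 * (s : ℝ) ^ 2 * (s + 2) * K ^ 2 * (2 * |(1 : ℝ)| + |U| + 2 * |μ|) * (L : ℝ) ^ 2
      ≤ 144 * (s : ℝ) ^ 2 * (s + 2) * K ^ 2 * (2 * (1 + |U| + |μ|)) * (L : ℝ) ^ 2 := by gcongr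
    _ = (288 * (s : ℝ) ^ 2 * (s + 2) * K ^ 2) * (1 + |U| + |μ|) * (L : ℝ) ^ 2 := by ring
    _ ≤ (288 * (s : ℝ) ^ 2 * (s + 2) * K ^ 2 + 1) * (1 + |U| + |μ|) * (L : ℝ) ^ 2 := by
        gcongr
        linarith

/-! ### The Koma–Tasaki trial-state bound for all real `U` -/

/-- **The Koma–Tasaki trial-state bound, all real `U`.** For the grand-canonical torus Hubbard
Hamiltonian `H = H(1,U) - μN`, the order operator `O = Δ_d + Δ_d†` and every normalised `n`-particle
vector `Ψ` with `⟨Ψ, O²Ψ⟩ ≥ s² > 0`, the sourced Hamiltonian `H - hO` (`h ≥ 0`) has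
`E₀(H - hO) ≤ E₀(H) + e/2 + B(1+|U|+|μ|)L³√e/s + B(1+|U|+|μ|)L²/s² - hs`, `e = Re⟨Ψ,HΨ⟩ - E₀(H)`
(trial vector `Ξ = (Ψ + OΨ/‖OΨ‖)/√2`). The tree's `stub_trialStateBound` is the case `U ≥ 0`; the proof
is the same, with the volume bounds above. [cite: KomaTasaki1994, Theorem 2.2] -/
theorem kt_trialStateBound :
    ∃ B : ℝ, 0 < B ∧ ∀ (L : ℕ) [NeZero L] (U μ h s : ℝ), 0 ≤ h → 0 < s →
      ∀ (Ψ : Fock (Orb (FermionTorus 2 L))) (n : ℕ), star Ψ ⬝ᵥ Ψ = 1 → IsNParticle n Ψ →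
        s ^ 2 ≤ (expect ((pairField dWaveFormFactor L + (pairField dWaveFormFactor L)ᴴ) *
          (pairField dWaveFormFactor L + (pairField dWaveFormFactor L)ᴴ)) Ψ).re →
        (dWaveSourceTorus L U μ h).groundEnergy ≤
          (hubbardTorusWith 2 L 1 U μ).groundEnergy +
            ((expect (hubbardTorusWith 2 L 1 U μ) Ψ).re - (hubbardTorusWith 2 L 1 U μ).groundEnergy) / 2 +
            B * (1 + |U| + |μ|) * (L : ℝ) ^ 3 *
              Real.sqrt ((expect (hubbardTorusWith 2 L 1 U μ) Ψ).re - (hubbardTorusWith 2 L 1 U μ).groundEnergy) / s +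
            B * (1 + |U| + |μ|) * (L : ℝ) ^ 2 / s ^ 2 - h * s := by
  -- adapted from `stub_trialStateBound` (WeakCouplingBCSWcbcsBcsConstructionTrialStateBound)
  obtain ⟨B₂, hB₂, hDn⟩ := kt_norm_doubleCommutator_le
  have hB₁ : (0 : ℝ) < 10 := by norm_num
  have hBd0 : 0 ≤ 2 * ∑ e ∈ insert (0 : Site 2) unitSteps, |dWaveFormFactor e / Real.sqrt 2| :=
    by positivity
  refine ⟨Real.sqrt (2 * 10) * (2 * ∑ e ∈ insert (0 : Site 2) unitSteps,
    |dWaveFormFactor e / Real.sqrt 2|) + B₂ / 4, by positivity, ?_⟩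
  intro L _ U μ h s hh hs Ψ n hΨ1 hΨn hs2
  have hNh : (totalNumber : Matrix (Finset (Orb (FermionTorus 2 L))) _ ℂ).IsHermitian :=
    totalNumber_isHermitian
  have hNΨ := totalNumber_mulVec_of_isNParticle hΨn
  have hNΔ := totalNumber_commutator_pairField_dWave L
  simp only [expect] at hs2 ⊢
  have key := stub_wcbcsTrialStateAbstract (isHermitian_hubbardTorusWith L 1 U μ)
    (isHermitian_pairField_add_conjTranspose L) hΨ1
    (star_dotProduct_charged_mulVec_eq_zero hNh hNΔ hNΨ)
    (star_mulVec_dotProduct_charged_mulVec_eq_zero hNh hNΔ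
      (totalNumber_commutator_hubbardTorusWith L U μ) hNΨ)
    (star_charged_mulVec_dotProduct_eq_zero hNh hNΔ hNΨ) hs hh hs2
  rw [dWaveSourceTorus_eq]
  have hK1 : 1 ≤ 1 + |U| + |μ| := by
    have := abs_nonneg μ
    have := abs_nonneg U
    linarith
  have hL : (0 : ℝ) < L := by exact_mod_cast Nat.pos_of_ne_zero (NeZero.ne L)
  exact trial_bound_arith hB₁ hB₂.le hBd0 hs hK1 hL (kt_norm_hubbardTorusWith_le L U μ)
    (norm_pairField_add_conjTranspose_le L) (hDn L U μ) (norm_nonneg _) key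

/-! ### From `Re⟨Δ_d† Δ_d⟩` to `⟨O²⟩` in a number eigenstate -/

/-- In a normalised `n`-particle vector, `Re⟨Ψ, O²Ψ⟩ ≥ 2 Re⟨Ψ, Δ_d†Δ_d Ψ⟩ - B_p L²`, `O = Δ_d + Δ_d†`:
the selection rule `⟨O²⟩ = ⟨Δ_dΔ_d† + Δ_d†Δ_d⟩` (`⟨Δ_d²⟩ = ⟨Δ_d†²⟩ = 0` by particle number) and the
pair-commutator budget `|Re⟨[Δ_d†, Δ_d]⟩| ≤ B_p L²` (graded locality). This is the step that produces the
constant `√(c/2)` of the engine: `‖Oψ‖² ≥ 2cL⁴ - O(L²)`. [cite: KomaTasaki1994, Theorem 2.2] -/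
theorem kt_two_mul_re_pair_le_re_order_sq :
    ∃ Bp : ℝ, 0 ≤ Bp ∧ ∀ (L : ℕ) [NeZero L] (Ψ : Fock (Orb (FermionTorus 2 L))) (n : ℕ),
      star Ψ ⬝ᵥ Ψ = 1 → IsNParticle n Ψ →
      2 * (expect ((pairField dWaveFormFactor L)ᴴ * pairField dWaveFormFactor L) Ψ).re -
          Bp * (L : ℝ) ^ 2 ≤
        (expect ((pairField dWaveFormFactor L + (pairField dWaveFormFactor L)ᴴ) *
          (pairField dWaveFormFactor L + (pairField dWaveFormFactor L)ᴴ)) Ψ).re := by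
  obtain ⟨B, hB0, hB⟩ := stub_pairCommutatorBudget
  refine ⟨B, hB0, fun L _ Ψ n hΨ1 hΨn => ?_⟩
  have hNh : (totalNumber : Matrix (Finset (Orb (FermionTorus 2 L))) _ ℂ).IsHermitian :=
    totalNumber_isHermitian
  have hsel := order_sq_expect_eq_pair (X := pairField dWaveFormFactor L) hNh
    (totalNumber_commutator_pairField_dWave L) (totalNumber_mulVec_of_isNParticle hΨn)
  have hbud := hB L 0 Ψ
  simp only [pairFieldAt_zero, hΨ1, Complex.one_re, mul_one] at hbud
  have h2 := (abs_le.1 hbud).2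
  rw [sub_mulVec, dotProduct_sub, Complex.sub_re] at h2
  simp only [expect]
  rw [hsel, add_mulVec, dotProduct_add, Complex.add_re]
  linarith

/-! ### Sector ground states as states of the grand-canonical Hamiltonian -/

/-- For a normalised `(N, S^z = 0)`-sector ground state `ψ` of `H(1,U)` on the torus,
`Re⟨ψ, (H(1,U) - μN)ψ⟩ = E_sec - μN`, `E_sec = minEnergyOn (szSector N 0) H(1,U)`. [folklore] -/
theorem kt_re_expect_hubbardTorusWith {L : ℕ} {U : ℝ} (μ : ℝ) {N : ℕ}
    {ψ : Fock (Orb (FermionTorus 2 L))} (hψ1 : star ψ ⬝ᵥ ψ = 1)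
    (hgs : IsGroundStateInSector (hubbardTorus 2 L 1 U) N 0 ψ) :
    (expect (hubbardTorusWith 2 L 1 U μ) ψ).re =
      (hubbardTorus 2 L 1 U).minEnergyOn (szSector N 0) - μ * N := by
  obtain ⟨hmem, -, hH⟩ := hgs
  have hN : IsNParticle N ψ := ((mem_szSector_iff N 0 ψ).1 hmem).1
  have hNψ := totalNumber_mulVec_of_isNParticle hN
  simp only [expect, hubbardTorusWith_eq, sub_mulVec, smul_mulVec, hH, hNψ, dotProduct_sub,
    dotProduct_smul, hψ1, smul_eq_mul, mul_one, Complex.sub_re, Complex.mul_re, Complex.ofReal_re,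
    Complex.ofReal_im, mul_zero, sub_zero]

/-- A sector ground state is in particular an `N`-particle vector. [folklore] -/
theorem kt_isNParticle_of_groundStateInSector {L : ℕ} {U : ℝ} {N : ℕ}
    {ψ : Fock (Orb (FermionTorus 2 L))}
    (hgs : IsGroundStateInSector (hubbardTorus 2 L 1 U) N 0 ψ) : IsNParticle N ψ :=
  ((mem_szSector_iff N 0 ψ).1 hgs.1).1

/-! ### Real arithmetic of the finite-volume bookkeeping -/

/-- The `ε`-bookkeeping of the engine (pure real arithmetic). With `σ = (3/2)√(c/2)`,
`s ≥ 2L²(√(c/2) - ε₁) ≥ σ L²` (`ε₁ ≤ √(c/2)/4`), energy excess `e ≤ ε' L²` with `ε' ≤ 4hε₁` and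
`BK√ε' ≤ 2hσε₁`, and `BK ≤ 2hσ²ε₁L⁴`, the gain inequality
`hs - e/2 - BK L³√e/s - BK L²/s² ≤ 2hL²·m` gives `√(c/2) - 4ε₁ ≤ m`. [folklore] -/
theorem kt_density_arith {m s e h L c ε₁ ε' BK : ℝ} (hh : 0 < h) (hL : 0 < L) (hc : 0 < c)
    (hε₁ : 0 < ε₁) (hε₁c : ε₁ ≤ Real.sqrt (c / 2) / 4) (hBK : 0 ≤ BK)
    (hs : 2 * L ^ 2 * (Real.sqrt (c / 2) - ε₁) ≤ s)
    (he : e ≤ ε' * L ^ 2) (hε'0 : 0 ≤ ε') (hε'1 : ε' ≤ 4 * h * ε₁)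
    (hε'2 : BK * Real.sqrt ε' ≤ 2 * h * (3 / 2 * Real.sqrt (c / 2)) * ε₁)
    (hL4 : BK ≤ 2 * h * (3 / 2 * Real.sqrt (c / 2)) ^ 2 * ε₁ * L ^ 4)
    (hgain : h * s - e / 2 - BK * L ^ 3 * Real.sqrt e / s - BK * L ^ 2 / s ^ 2 ≤ 2 * h * L ^ 2 * m) :
    Real.sqrt (c / 2) - 4 * ε₁ ≤ m := by
  set σ : ℝ := 3 / 2 * Real.sqrt (c / 2) with hσ_def
  have hsqc : 0 < Real.sqrt (c / 2) := Real.sqrt_pos.2 (by positivity)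
  have hσ : 0 < σ := by positivity
  have hL2 : 0 < L ^ 2 := by positivity
  have hL4' : 0 < L ^ 4 := by positivity
  -- `s ≥ σ L² > 0`
  have hsσ : σ * L ^ 2 ≤ s := by
    have : σ ≤ 2 * (Real.sqrt (c / 2) - ε₁) := by rw [hσ_def]; linarith
    nlinarith
  have hs0 : 0 < s := lt_of_lt_of_le (by positivity) hsσ
  -- term 2
  have hT2 : e / 2 ≤ 2 * h * ε₁ * L ^ 2 := by nlinarith
  -- term 3
  have hsqe : Real.sqrt e ≤ Real.sqrt ε' * L := by
    calc Real.sqrt e ≤ Real.sqrt (ε' * L ^ 2) := Real.sqrt_le_sqrt he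
      _ = Real.sqrt ε' * L := by rw [Real.sqrt_mul hε'0, Real.sqrt_sq hL.le]
  have hT3 : BK * L ^ 3 * Real.sqrt e / s ≤ 2 * h * ε₁ * L ^ 2 := by
    rw [div_le_iff₀ hs0]
    have h1 : BK * L ^ 3 * Real.sqrt e ≤ BK * L ^ 3 * (Real.sqrt ε' * L) :=
      mul_le_mul_of_nonneg_left hsqe (by positivity)
    have h2 : BK * L ^ 3 * (Real.sqrt ε' * L) = (BK * Real.sqrt ε') * L ^ 4 := by ring
    have h3 : (BK * Real.sqrt ε') * L ^ 4 ≤ (2 * h * σ * ε₁) * L ^ 4 :=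
      mul_le_mul_of_nonneg_right hε'2 hL4'.le
    have h4 : (2 * h * σ * ε₁) * L ^ 4 = 2 * h * ε₁ * L ^ 2 * (σ * L ^ 2) := by ring
    have h5 : 2 * h * ε₁ * L ^ 2 * (σ * L ^ 2) ≤ 2 * h * ε₁ * L ^ 2 * s :=
      mul_le_mul_of_nonneg_left hsσ (by positivity)
    linarith
  -- term 4
  have hT4 : BK * L ^ 2 / s ^ 2 ≤ 2 * h * ε₁ * L ^ 2 := by
    rw [div_le_iff₀ (by positivity)]
    have h1 : (σ * L ^ 2) ^ 2 ≤ s ^ 2 := by gcongr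
    have h2 : BK * L ^ 2 ≤ 2 * h * ε₁ * L ^ 2 * (σ * L ^ 2) ^ 2 := by nlinarith
    have h3 : 2 * h * ε₁ * L ^ 2 * (σ * L ^ 2) ^ 2 ≤ 2 * h * ε₁ * L ^ 2 * s ^ 2 :=
      mul_le_mul_of_nonneg_left h1 (by positivity)
    linarith
  -- assemble
  have hmain : 2 * h * L ^ 2 * (Real.sqrt (c / 2) - 4 * ε₁) ≤ 2 * h * L ^ 2 * m := by
    have hs' : h * (2 * L ^ 2 * (Real.sqrt (c / 2) - ε₁)) ≤ h * s :=
      mul_le_mul_of_nonneg_left hs hh.le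
    nlinarith
  exact le_of_mul_le_mul_left hmain (by positivity)

/-! ### The engine -/

/-- **`SourcedOrderDominatesLRO` holds** (route `AbsenceCertificate`, support item
`stmt-HubbardSuperconductivity-9486`; Kaplan–Horsch–von der Linden 1989 / Koma–Tasaki 1994, Thm 2.2
direction "LRO ⇒ sourced order"): for all real `U, μ`, every `N : ℕ → ℕ` and normalised
`(N_L, S^z = 0)`-sector ground states `ψ_L` of `hubbardTorus 2 L 1 U` at even `L` whose sectors are
canonically supported by `μ`, an eventual bound `cL⁴ ≤ Re⟨ψ_L, Δ_d†Δ_d ψ_L⟩` (`c > 0`) gives, for every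
`h > 0` and `ε > 0`, `√(c/2) - ε ≤ dWaveSourceDensity L U μ h` for all large even `L`.
Proof: at each large even `L`, `ψ_L` is an `N_L`-particle unit vector with
`Re⟨ψ_L,(H - μN)ψ_L⟩ - E₀(H - μN) = E_sec - μN_L - E₀^{gc} ≤ ε'L²` and
`⟨O²⟩ ≥ 2cL⁴ - B_pL² ≥ (2L²(√(c/2) - ε/4))²`; the trial-state bound at `s = 2L²(√(c/2) - ε/4)` and the
energy sandwich `E(0) - E(h) ≤ 2hL²·m_L(h)` give `m_L(h) ≥ √(c/2) - ε` by `kt_density_arith`.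
[cite: KomaTasaki1994, Theorem 2.2] -/
theorem sourcedOrderDominatesLRO_proof : SourcedOrderDominatesLRO := by
  intro U μ N ψ hψ hsup c hc hLRO h hh ε hε
  -- the trivial case `ε ≥ √(c/2)`: the sourced density is nonnegative for `h ≥ 0`
  by_cases hεbig : Real.sqrt (c / 2) ≤ ε
  · refine ⟨0, fun L _ _ _ => ?_⟩
    have := dWaveSourceDensity_nonneg (L := L) U μ hh.le
    linarith
  push Not at hεbig
  -- constants
  obtain ⟨B, hB, htrial⟩ := kt_trialStateBound
  obtain ⟨Bp, hBp, horder⟩ := kt_two_mul_re_pair_le_re_order_sq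
  obtain ⟨L₁, hL₁⟩ := hLRO
  set K : ℝ := 1 + |U| + |μ| with hK_def
  have hK : 1 ≤ K := by
    have := abs_nonneg U
    have := abs_nonneg μ
    rw [hK_def]; linarith
  set BK : ℝ := B * K with hBK_def
  have hBK : 0 ≤ BK := by positivity
  set ε₁ : ℝ := ε / 4 with hε₁_def
  have hε₁ : 0 < ε₁ := by positivity
  have hsqc : 0 < Real.sqrt (c / 2) := Real.sqrt_pos.2 (by positivity)
  have hε₁c : ε₁ ≤ Real.sqrt (c / 2) / 4 := by rw [hε₁_def]; linarith
  set σ : ℝ := 3 / 2 * Real.sqrt (c / 2) with hσ_def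
  have hσ : 0 < σ := by positivity
  set ε' : ℝ := min (4 * h * ε₁) ((2 * h * σ * ε₁ / (BK + 1)) ^ 2) with hε'_def
  have hε'0 : 0 < ε' := lt_min (by positivity) (by positivity)
  have hε'1 : ε' ≤ 4 * h * ε₁ := min_le_left _ _
  have hε'2 : BK * Real.sqrt ε' ≤ 2 * h * σ * ε₁ := by
    have h1 : Real.sqrt ε' ≤ 2 * h * σ * ε₁ / (BK + 1) := by
      calc Real.sqrt ε' ≤ Real.sqrt ((2 * h * σ * ε₁ / (BK + 1)) ^ 2) :=
            Real.sqrt_le_sqrt (min_le_right _ _)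
        _ = 2 * h * σ * ε₁ / (BK + 1) := Real.sqrt_sq (by positivity)
    calc BK * Real.sqrt ε' ≤ BK * (2 * h * σ * ε₁ / (BK + 1)) :=
          mul_le_mul_of_nonneg_left h1 hBK
      _ ≤ (BK + 1) * (2 * h * σ * ε₁ / (BK + 1)) :=
          mul_le_mul_of_nonneg_right (by linarith) (by positivity)
      _ = 2 * h * σ * ε₁ := by field_simp
  obtain ⟨L₃, hL₃⟩ := hsup ε' hε'0
  -- the threshold
  refine ⟨max (max L₁ L₃) (max ⌈Bp / (4 * ε₁ * Real.sqrt (c / 2))⌉₊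
    (max ⌈BK / (2 * h * σ ^ 2 * ε₁)⌉₊ 1)), ?_⟩
  intro L _ hLeven hL0
  simp only [max_le_iff] at hL0
  obtain ⟨⟨hL1, hL3⟩, hLBp, hLBK, hL1'⟩ := hL0
  have hLpos : (0 : ℝ) < L := by exact_mod_cast hL1'
  have hLge1 : (1 : ℝ) ≤ L := by exact_mod_cast hL1'
  -- the state at side `L`
  obtain ⟨hψ1, hgs⟩ := hψ L hLeven
  have hNψ : IsNParticle (N L) (ψ L) := kt_isNParticle_of_groundStateInSector hgs
  -- energy excess `e ≤ ε' L²`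
  have he : (expect (hubbardTorusWith 2 L 1 U μ) (ψ L)).re -
      (hubbardTorusWith 2 L 1 U μ).groundEnergy ≤ ε' * (L : ℝ) ^ 2 := by
    rw [kt_re_expect_hubbardTorusWith μ hψ1 hgs]
    exact (le_abs_self _).trans (hL₃ L hLeven hL3)
  -- the order operator: `⟨O²⟩ ≥ 2cL⁴ - Bp L² ≥ s²`, `s = 2L²(√(c/2) - ε₁)`
  have hc4 := hL₁ L hLeven hL1
  have hO2 := horder L (ψ L) (N L) hψ1 hNψ
  set s : ℝ := 2 * (L : ℝ) ^ 2 * (Real.sqrt (c / 2) - ε₁) with hs_def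
  have hs0 : 0 < s := by
    have : 0 < Real.sqrt (c / 2) - ε₁ := by linarith
    positivity
  have hBpL : Bp ≤ 4 * ε₁ * Real.sqrt (c / 2) * (L : ℝ) ^ 2 := by
    have h1 : Bp / (4 * ε₁ * Real.sqrt (c / 2)) ≤ L := (Nat.le_ceil _).trans (by exact_mod_cast hLBp)
    rw [div_le_iff₀ (by positivity)] at h1
    nlinarith
  have hs2 : s ^ 2 ≤ (expect ((pairField dWaveFormFactor L + (pairField dWaveFormFactor L)ᴴ) *
      (pairField dWaveFormFactor L + (pairField dWaveFormFactor L)ᴴ)) (ψ L)).re := by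
    have hsq : Real.sqrt (c / 2) ^ 2 = c / 2 := Real.sq_sqrt (by positivity)
    have hkey : s ^ 2 ≤ 2 * (c * (L : ℝ) ^ 4) - Bp * (L : ℝ) ^ 2 := by
      rw [hs_def]
      have hL4 : (0 : ℝ) ≤ (L : ℝ) ^ 4 := by positivity
      nlinarith [hBpL, hε₁c, hsq, mul_nonneg hL4 hε₁.le]
    linarith
  -- the trial-state bound and the energy sandwich
  have htr := htrial L U μ h s hh.le hs0 (ψ L) (N L) hψ1 hNψ hs2
  have hgain := groundEnergy_gain_le_dWaveSourceDensity (L := L) U μ h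
  rw [dWaveSourceTorus_zero] at hgain
  -- bookkeeping
  have hL4 : BK ≤ 2 * h * σ ^ 2 * ε₁ * (L : ℝ) ^ 4 := by
    have h1 : BK / (2 * h * σ ^ 2 * ε₁) ≤ L := (Nat.le_ceil _).trans (by exact_mod_cast hLBK)
    rw [div_le_iff₀ (by positivity)] at h1
    have h2 : (L : ℝ) ≤ (L : ℝ) ^ 4 := by
      calc (L : ℝ) = L * 1 * 1 * 1 := by ring
        _ ≤ L * L * L * L := by gcongr
        _ = (L : ℝ) ^ 4 := by ring
    calc BK ≤ L * (2 * h * σ ^ 2 * ε₁) := h1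
      _ ≤ (L : ℝ) ^ 4 * (2 * h * σ ^ 2 * ε₁) := mul_le_mul_of_nonneg_right h2 (by positivity)
      _ = _ := by ring
  have hfin := kt_density_arith (m := dWaveSourceDensity L U μ h) hh hLpos hc hε₁ hε₁c hBK
    (le_refl s) he hε'0.le hε'1 hε'2 hL4 (by
      have hBKK : BK = B * (1 + |U| + |μ|) := by rw [hBK_def, hK_def]
      rw [hBKK]
      linarith [htr, hgain])
  rw [hε₁_def] at hfin
  linarith

end Summit.HubbardSuperconductivity.HubbardSuperconductivity.Theorems.AbsenceCertificate

end
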